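import Mathlib
import Summits.AtomisticToContinuum.HydrodynamicLimit.Theorems.ImplosionDichotomyDenseExcursionSonicCavityDefsC

/-!
# Geometry of the sonic wedge: openness, star-convexity, and a cover of the punctured wedge by star-shaped pieces
# (crux `DenseExcursion`, line `sonic-cavity-renewal` v7, bricks for the registered stub `stub_sonicSlaving`)

Helper file (`--supports stmt-AtomisticToContinuum-12586`, line lead a2, stub-worker A (wave 3) for `stub_sonicSlaving`).

The contour-transport route to `SonicSlaving` (worker report `work/stubs/W2_sonicSlaving.REPORT.md` §3, part C of the tube
`…SonicCavityDefsC`) continues a smooth radial mode analytically from the sonic point to the whole complex wedge `sonicWedge`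
by solving the (regular, linear, holomorphic-coefficient) characteristic system on star-shaped pieces of the PUNCTURED wedge
(the system is singular only at the sonic point `z = 0`) with the Literature theorem
`Literature.Analysis.ODE.exists_holomorphic_linearODE_of_starConvex`, and gluing by the identity theorem. This file is the
geometry of that cover:

* `mem_sonicWedge_iff` (the disc in the definition is redundant), `isOpen_sonicWedge`, `ball_subset_sonicWedge`,
  `starConvex_sonicWedge` (registered helper: the wedge is star-shaped with respect to the sonic point);
* the four pieces `sonicWedge ∩ {Re z < 0}` (star-shaped with respect to every real point `c ∈ (−4/5, 0)`: union of the cone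
  `|Im z| < (3/20)|Re z|` and the strip `|Im z| < 1/20`, both convex), `sonicWedge ∩ {0 < Im z < 1/20}`,
  `sonicWedge ∩ {−1/20 < Im z < 0}`, `sonicWedge ∩ {0 < Re z}` (convex), which are open, avoid `0`, and cover
  `sonicWedge ∖ {0}` (`sonicWedge_cover`);
* two generic one-variable facts used by the gluing: a holomorphic function on a disc around `0` vanishing on the real
  diameter vanishes (`eqOn_zero_ball_of_ofReal`, identity theorem), and the complex derivative of a holomorphic function at a
  real point is the real derivative of its real trace (`deriv_eq_of_realTrace`).

NOT here: any ODE. No citation is load-bearing (elementary plane geometry + Mathlib's identity theorem).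
-/

noncomputable section

open Set Filter Metric Complex
open scoped Topology

namespace Summit.AtomisticToContinuum.HydrodynamicLimit.Theorems.SonicCavityRenewal

open Summit.AtomisticToContinuum.HydrodynamicLimit.Theorems.R2OneModeTwoConditions

/-! ## The wedge -/

/-- The disc `‖z‖ < 1/20` of the definition lies in the wedge-with-strip part. [folklore] -/
theorem ball_subset_sonicWedge_core :
    ball (0 : ℂ) (1 / 20) ⊆ {z : ℂ | -(4 / 5 : ℝ) < z.re ∧ z.re < 1 / 20 ∧ |z.im| < max (3 / 20 * |z.re|) (1 / 20)} := by
  intro z hz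
  rw [mem_ball_zero_iff] at hz
  have hre : |z.re| < 1 / 20 := lt_of_le_of_lt (abs_re_le_norm z) hz
  have him : |z.im| < 1 / 20 := lt_of_le_of_lt (abs_im_le_norm z) hz
  refine ⟨by linarith [neg_abs_le z.re], (le_abs_self z.re).trans_lt hre, lt_max_of_lt_right him⟩

/-- Membership in the sonic wedge: `−4/5 < Re z < 1/20` and `|Im z| < max((3/20)|Re z|, 1/20)`. [folklore] -/
theorem mem_sonicWedge_iff {z : ℂ} :
    z ∈ sonicWedge ↔ -(4 / 5 : ℝ) < z.re ∧ z.re < 1 / 20 ∧ |z.im| < max (3 / 20 * |z.re|) (1 / 20) := by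
  refine ⟨fun h => ?_, fun h => Or.inl h⟩
  rcases h with h | h
  · exact h
  · exact ball_subset_sonicWedge_core h

/-- The sonic wedge is open. [folklore] -/
theorem isOpen_sonicWedge : IsOpen sonicWedge := by
  refine IsOpen.union ?_ isOpen_ball
  refine (isOpen_lt continuous_const continuous_re).inter ((isOpen_lt continuous_re continuous_const).inter ?_)
  exact isOpen_lt (continuous_abs.comp continuous_im)
    ((continuous_const.mul (continuous_abs.comp continuous_re)).max continuous_const)

/-- Discs of radius `≤ 1/20` around the sonic point lie in the wedge. [folklore] -/
theorem ball_subset_sonicWedge {δ : ℝ} (hδ : δ ≤ 1 / 20) : ball (0 : ℂ) δ ⊆ sonicWedge :=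
  fun _ hz => Or.inr (ball_subset_ball hδ hz)

/-- **The sonic wedge is star-shaped with respect to the sonic point** — registered helper `starConvex_sonicWedge` for
`stub_sonicSlaving`: scaling a wedge point towards `0` keeps `Re` in range and `|Im (t z)| = t|Im z|` below
`max((3/20)|Re(t z)|, 1/20)`. [folklore] -/
theorem starConvex_sonicWedge : StarConvex ℝ (0 : ℂ) sonicWedge := by
  intro y hy a b ha hb hab
  rw [smul_zero, zero_add, mem_sonicWedge_iff]
  obtain ⟨h1, h2, h3⟩ := mem_sonicWedge_iff.1 hy
  have hb1 : b ≤ 1 := by linarith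
  simp only [Complex.real_smul, Complex.mul_re, Complex.ofReal_re, Complex.ofReal_im, zero_mul, sub_zero,
    Complex.mul_im, add_zero]
  refine ⟨by nlinarith, by nlinarith, ?_⟩
  rw [abs_mul, abs_of_nonneg hb, abs_mul, abs_of_nonneg hb]
  rcases lt_max_iff.1 h3 with h | h
  · rcases hb.eq_or_lt with rfl | hb0
    · simp
    · exact lt_max_of_lt_left (by nlinarith)
  · exact lt_max_of_lt_right (by nlinarith [abs_nonneg y.im])

/-! ## The four pieces of the punctured wedge -/

/-- The left piece `sonicWedge ∩ {Re z < 0}` is the union of the cone `−4/5 < Re z < 0`, `|Im z| < (3/20)|Re z|` and the strip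
`−4/5 < Re z < 0`, `|Im z| < 1/20`. [folklore] -/
theorem sonicWedge_inter_left_eq :
    sonicWedge ∩ {z : ℂ | z.re < 0} =
      ({z : ℂ | -(4 / 5 : ℝ) < z.re} ∩ {z : ℂ | z.re < 0} ∩ {z : ℂ | z.im + 3 / 20 * z.re < 0} ∩
          {z : ℂ | -z.im + 3 / 20 * z.re < 0}) ∪
        ({z : ℂ | -(4 / 5 : ℝ) < z.re} ∩ {z : ℂ | z.re < 0} ∩ {z : ℂ | z.im < 1 / 20} ∩ {z : ℂ | -(1 / 20 : ℝ) < z.im}) := by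
  ext z
  simp only [mem_inter_iff, mem_sonicWedge_iff, mem_setOf_eq, mem_union]
  constructor
  · rintro ⟨⟨h1, -, h3⟩, h4⟩
    rw [abs_of_neg h4] at h3
    rcases lt_max_iff.1 h3 with h | h
    · exact Or.inl ⟨⟨⟨h1, h4⟩, by linarith [le_abs_self z.im]⟩, by linarith [neg_abs_le z.im]⟩
    · exact Or.inr ⟨⟨⟨h1, h4⟩, by linarith [le_abs_self z.im]⟩, by linarith [neg_abs_le z.im]⟩
  · rintro (⟨⟨⟨h1, h4⟩, h5⟩, h6⟩ | ⟨⟨⟨h1, h4⟩, h5⟩, h6⟩)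
    · refine ⟨⟨h1, by linarith, ?_⟩, h4⟩
      rw [abs_of_neg h4]
      exact lt_max_of_lt_left (abs_lt.2 ⟨by linarith, by linarith⟩)
    · exact ⟨⟨h1, by linarith, lt_max_of_lt_right (abs_lt.2 ⟨by linarith, by linarith⟩)⟩, h4⟩

/-- The two slanted half-planes bounding the cone are convex. [folklore] -/
theorem convex_slantedHalfPlane (s : ℝ) : Convex ℝ {z : ℂ | s * z.im + 3 / 20 * z.re < 0} := by
  refine convex_halfSpace_lt ⟨fun z w => ?_, fun c z => ?_⟩ 0
  · simp only [Complex.add_im, Complex.add_re]; ring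
  · simp only [Complex.real_smul, Complex.mul_im, Complex.ofReal_re, Complex.ofReal_im, zero_mul, add_zero,
      Complex.mul_re, sub_zero, smul_eq_mul]; ring

/-- **The left piece is star-shaped with respect to every real point of `(−4/5, 0)`** (union of two convex sets containing
the point). [folklore] -/
theorem starConvex_sonicWedge_left {c : ℝ} (h1 : -(4 / 5 : ℝ) < c) (h2 : c < 0) :
    StarConvex ℝ ((c : ℝ) : ℂ) (sonicWedge ∩ {z : ℂ | z.re < 0}) := by
  rw [sonicWedge_inter_left_eq]
  refine StarConvex.union (Convex.starConvex ?_ ?_) (Convex.starConvex ?_ ?_)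
  · refine (((convex_halfSpace_re_gt _).inter (convex_halfSpace_re_lt _)).inter ?_).inter ?_
    · simpa using convex_slantedHalfPlane 1
    · simpa using convex_slantedHalfPlane (-1)
  · simp only [mem_inter_iff, mem_setOf_eq, Complex.ofReal_re, Complex.ofReal_im, zero_add, neg_zero]
    exact ⟨⟨⟨h1, h2⟩, by linarith⟩, by linarith⟩
  · exact (((convex_halfSpace_re_gt _).inter (convex_halfSpace_re_lt _)).inter (convex_halfSpace_im_lt _)).inter
      (convex_halfSpace_im_gt _)
  · simp only [mem_inter_iff, mem_setOf_eq, Complex.ofReal_re, Complex.ofReal_im]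
    exact ⟨⟨⟨h1, h2⟩, by norm_num⟩, by norm_num⟩

/-- The upper strip piece `sonicWedge ∩ {0 < Im z < 1/20}` is a rectangle. [folklore] -/
theorem sonicWedge_inter_up_eq :
    sonicWedge ∩ {z : ℂ | 0 < z.im ∧ z.im < 1 / 20} =
      {z : ℂ | -(4 / 5 : ℝ) < z.re} ∩ {z : ℂ | z.re < 1 / 20} ∩ {z : ℂ | 0 < z.im} ∩ {z : ℂ | z.im < 1 / 20} := by
  ext z
  simp only [mem_inter_iff, mem_sonicWedge_iff, mem_setOf_eq]
  constructor
  · rintro ⟨⟨h1, h2, -⟩, h4, h5⟩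
    exact ⟨⟨⟨h1, h2⟩, h4⟩, h5⟩
  · rintro ⟨⟨⟨h1, h2⟩, h4⟩, h5⟩
    exact ⟨⟨h1, h2, lt_max_of_lt_right (abs_lt.2 ⟨by linarith, h5⟩)⟩, h4, h5⟩

/-- The lower strip piece `sonicWedge ∩ {−1/20 < Im z < 0}` is a rectangle. [folklore] -/
theorem sonicWedge_inter_down_eq :
    sonicWedge ∩ {z : ℂ | z.im < 0 ∧ -(1 / 20 : ℝ) < z.im} =
      {z : ℂ | -(4 / 5 : ℝ) < z.re} ∩ {z : ℂ | z.re < 1 / 20} ∩ {z : ℂ | z.im < 0} ∩ {z : ℂ | -(1 / 20 : ℝ) < z.im} := by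
  ext z
  simp only [mem_inter_iff, mem_sonicWedge_iff, mem_setOf_eq]
  constructor
  · rintro ⟨⟨h1, h2, -⟩, h4, h5⟩
    exact ⟨⟨⟨h1, h2⟩, h4⟩, h5⟩
  · rintro ⟨⟨⟨h1, h2⟩, h4⟩, h5⟩
    exact ⟨⟨h1, h2, lt_max_of_lt_right (abs_lt.2 ⟨by linarith, by linarith⟩)⟩, h4, h5⟩

/-- The right piece `sonicWedge ∩ {0 < Re z}` is a rectangle (for `Re z > 0` the cone is inside the strip). [folklore] -/
theorem sonicWedge_inter_right_eq :
    sonicWedge ∩ {z : ℂ | 0 < z.re} =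
      {z : ℂ | 0 < z.re} ∩ {z : ℂ | z.re < 1 / 20} ∩ {z : ℂ | z.im < 1 / 20} ∩ {z : ℂ | -(1 / 20 : ℝ) < z.im} := by
  ext z
  simp only [mem_inter_iff, mem_sonicWedge_iff, mem_setOf_eq]
  constructor
  · rintro ⟨⟨-, h2, h3⟩, h4⟩
    have h3' : |z.im| < 1 / 20 := by
      rcases lt_max_iff.1 h3 with h | h
      · rw [abs_of_pos h4] at h; linarith
      · exact h
    exact ⟨⟨⟨h4, h2⟩, (le_abs_self _).trans_lt h3'⟩, by linarith [neg_abs_le z.im]⟩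
  · rintro ⟨⟨⟨h4, h2⟩, h5⟩, h6⟩
    exact ⟨⟨by linarith, h2, lt_max_of_lt_right (abs_lt.2 ⟨by linarith, h5⟩)⟩, h4⟩

/-- The three rectangular pieces are convex. [folklore] -/
theorem convex_sonicWedge_pieces :
    Convex ℝ (sonicWedge ∩ {z : ℂ | 0 < z.im ∧ z.im < 1 / 20}) ∧
      Convex ℝ (sonicWedge ∩ {z : ℂ | z.im < 0 ∧ -(1 / 20 : ℝ) < z.im}) ∧ Convex ℝ (sonicWedge ∩ {z : ℂ | 0 < z.re}) := by
  refine ⟨?_, ?_, ?_⟩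
  · rw [sonicWedge_inter_up_eq]
    exact (((convex_halfSpace_re_gt _).inter (convex_halfSpace_re_lt _)).inter (convex_halfSpace_im_gt _)).inter
      (convex_halfSpace_im_lt _)
  · rw [sonicWedge_inter_down_eq]
    exact (((convex_halfSpace_re_gt _).inter (convex_halfSpace_re_lt _)).inter (convex_halfSpace_im_lt _)).inter
      (convex_halfSpace_im_gt _)
  · rw [sonicWedge_inter_right_eq]
    exact (((convex_halfSpace_re_gt _).inter (convex_halfSpace_re_lt _)).inter (convex_halfSpace_im_lt _)).inter
      (convex_halfSpace_im_gt _)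

/-- The four pieces are open. [folklore] -/
theorem isOpen_sonicWedge_pieces :
    IsOpen (sonicWedge ∩ {z : ℂ | z.re < 0}) ∧ IsOpen (sonicWedge ∩ {z : ℂ | 0 < z.im ∧ z.im < 1 / 20}) ∧
      IsOpen (sonicWedge ∩ {z : ℂ | z.im < 0 ∧ -(1 / 20 : ℝ) < z.im}) ∧ IsOpen (sonicWedge ∩ {z : ℂ | 0 < z.re}) := by
  refine ⟨isOpen_sonicWedge.inter (isOpen_lt continuous_re continuous_const),
    isOpen_sonicWedge.inter ((isOpen_lt continuous_const continuous_im).inter (isOpen_lt continuous_im continuous_const)),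
    isOpen_sonicWedge.inter ((isOpen_lt continuous_im continuous_const).inter (isOpen_lt continuous_const continuous_im)),
    isOpen_sonicWedge.inter (isOpen_lt continuous_const continuous_re)⟩

/-- **The pieces cover the punctured wedge**: a wedge point other than the sonic point has `Re z < 0`, or `Re z > 0`, or
(`Re z = 0` and then `|Im z| < 1/20`) `0 < Im z < 1/20` or `−1/20 < Im z < 0`. [folklore] -/
theorem sonicWedge_cover {z : ℂ} (hz : z ∈ sonicWedge) (h0 : z ≠ 0) :
    z.re < 0 ∨ 0 < z.re ∨ (0 < z.im ∧ z.im < 1 / 20) ∨ (z.im < 0 ∧ -(1 / 20 : ℝ) < z.im) := by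
  obtain ⟨-, -, h3⟩ := mem_sonicWedge_iff.1 hz
  rcases lt_trichotomy z.re 0 with h | h | h
  · exact Or.inl h
  · rw [h, abs_zero, mul_zero, max_eq_right (by norm_num : (0 : ℝ) ≤ 1 / 20)] at h3
    obtain ⟨h4, h5⟩ := abs_lt.1 h3
    rcases lt_trichotomy z.im 0 with h' | h' | h'
    · exact Or.inr (Or.inr (Or.inr ⟨h', h4⟩))
    · exact absurd (Complex.ext h h') h0
    · exact Or.inr (Or.inr (Or.inl ⟨h', h5⟩))
  · exact Or.inr (Or.inl h)

/-- The pieces avoid the sonic point. [folklore] -/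
theorem zero_notMem_sonicWedge_pieces {z : ℂ}
    (h : z.re < 0 ∨ 0 < z.re ∨ (0 < z.im ∧ z.im < 1 / 20) ∨ (z.im < 0 ∧ -(1 / 20 : ℝ) < z.im)) : z ≠ 0 := by
  rintro rfl
  simp at h

/-! ## Two one-variable facts for the gluing -/

/-- Real points `0 < x < δ` accumulate at `0` in the punctured plane: a property holding at all of them holds frequently
near `0`. [folklore] -/
theorem frequently_nhdsNE_zero_of_ofReal {p : ℂ → Prop} {δ : ℝ} (hδ : 0 < δ) (h : ∀ x : ℝ, 0 < x → x < δ → p x) :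
    ∃ᶠ z in 𝓝[≠] (0 : ℂ), p z := by
  have hu : Tendsto (fun n : ℕ => (((δ / (n + 2) : ℝ) : ℂ))) atTop (𝓝[≠] (0 : ℂ)) := by
    refine tendsto_nhdsWithin_iff.2 ⟨?_, Eventually.of_forall fun n => ?_⟩
    · have h1 : Tendsto (fun n : ℕ => (δ / (n + 2) : ℝ)) atTop (𝓝 0) := by
        have := tendsto_const_div_atTop_nhds_zero_nat δ
        refine (this.comp (tendsto_add_atTop_nat 2)).congr fun n => ?_
        simp
      have h2 := (Complex.continuous_ofReal.tendsto 0).comp h1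
      rw [Complex.ofReal_zero] at h2
      refine h2.congr fun n => ?_
      simp
    · simp only [mem_compl_iff, mem_singleton_iff, Complex.ofReal_eq_zero]
      positivity
  refine hu.frequently (Eventually.of_forall fun n => h _ (by positivity) ?_).frequently
  rw [div_lt_iff₀ (by positivity)]
  nlinarith

/-- **A holomorphic function on a disc around `0` vanishing on the positive real radius vanishes on the disc** (identity
theorem at the accumulation point `0`). [folklore] -/
theorem eqOn_zero_ball_of_ofReal {f : ℂ → ℂ} {δ : ℝ} (hδ : 0 < δ) (hf : DifferentiableOn ℂ f (ball 0 δ))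
    (h : ∀ x : ℝ, 0 < x → x < δ → f x = 0) : ∀ z ∈ ball (0 : ℂ) δ, f z = 0 := by
  have ha : AnalyticOnNhd ℂ f (ball 0 δ) := hf.analyticOnNhd isOpen_ball
  have := ha.eqOn_zero_of_preconnected_of_frequently_eq_zero (convex_ball (0 : ℂ) δ).isPreconnected (mem_ball_self hδ)
    (frequently_nhdsNE_zero_of_ofReal hδ h)
  exact fun z hz => this hz

/-- **The complex derivative at a real point is the real derivative of the real trace**: if `P` is complex-differentiable
at the real point `x`, `p : ℝ → ℂ` has derivative `p′` at `x`, and `P t = p t` for real `t` near `x`, then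
`deriv P x = p′`. [folklore] -/
theorem deriv_eq_of_realTrace {P : ℂ → ℂ} {p : ℝ → ℂ} {p' : ℂ} {x : ℝ} (hP : DifferentiableAt ℂ P x)
    (hp : HasDerivAt p p' x) (heq : ∀ᶠ t : ℝ in 𝓝 x, P t = p t) : deriv P x = p' := by
  have h1 : HasDerivAt (fun t : ℝ => P t) (deriv P x) x := hP.hasDerivAt.comp_ofReal
  exact (h1.congr_of_eventuallyEq (heq.mono fun t ht => ht.symm)).unique hp

/-- Real points of `(−4/5, 0)` lie in the left piece, real points of `(0, 1/20)` in the right piece. [folklore] -/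
theorem ofReal_mem_sonicWedge_pieces {x : ℝ} (h1 : -(4 / 5 : ℝ) < x) (h2 : x < 1 / 20) :
    (x < 0 → (x : ℂ) ∈ sonicWedge ∩ {z : ℂ | z.re < 0}) ∧ (0 < x → (x : ℂ) ∈ sonicWedge ∩ {z : ℂ | 0 < z.re}) :=
  ⟨fun hx => ⟨ofReal_mem_sonicWedge h1 h2, by simpa using hx⟩, fun hx => ⟨ofReal_mem_sonicWedge h1 h2, by simpa using hx⟩⟩

end Summit.AtomisticToContinuum.HydrodynamicLimit.Theorems.SonicCavityRenewal

end
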